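import Summits.QuantumFields.YangMills.Theorems.UnitScaleTiltFluctuationComparisonRegPrAnsatzTStub

/-!
# Route `UnitScaleTilt` — crux `FluctuationComparisonRegPrIntL` (stmt-QuantumFields-20520, DECIDING), skeleton v5kC
# (`Cruxes/FluctuationComparisonRegPrIntL/Lines/birth_v5kC.lean`, sha16 3aa24e4fa8fcb956): **STUB 1 `stub_oneStepSmallLift` BY NAME**.

The registered STUB 1 of v5kC is byte-identical with STUB 1 of the earlier skeletons v5h/v5j‴/v5k and is CLOSED in the tree by
`Summit.QuantumFields.YangMills.Theorems.ApproxLift.AnsatzT.stub_oneStepSmallLift` (p490827, filed under stmt-QuantumFields-19935).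
v5kC re-lists it as a `sorry` («re-listed until the olean rebuild», owner pen ym3-torus-plan g23); this file records the by-name
credit against stmt-QuantumFields-20520 so that the registry's open-stub list is {2′χ, 3⁗χ, (i*)χ, T8}.  Nothing new is proved here;
the `L = 3` clause upstream rests on the certified face-supported table (`CertL3Tree.certL3_clause`, `native_decide` certificate facts),
so this declaration is computational in the same sense as p490827.

Cell `ym3-torus` (HUMAN RULING D-0037: YM₃ on T³ is ladder rung R3, not the Clay problem), seat `ym-ust-20520-w3` gen 2.
-/

noncomputable section

namespace Summit.QuantumFields.YangMills.Theorems.IntLStub1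

open Literature.MathematicalPhysics.QuantumFieldTheory.Balaban1983to89
open Literature.MathematicalPhysics.QuantumFieldTheory.Balaban1983to89.T3ContinuumYM3Torus
open Literature.MathematicalPhysics.QuantumFieldTheory.Balaban1983to89.T3UnitLawDensityEML (ℰp)
open Literature.MathematicalPhysics.QuantumFieldTheory.Balaban1983to89.T3SmallLiftHistory (OneStepSmallLift)

/-- **STUB 1 of v5kC, `stub_oneStepSmallLift`, BY NAME** (registered text verbatim): for every block size `L` there are a gain `κ` with
`κ√L ≤ 1` and a threshold `δ₀ > 0` such that every `T3Family` of block size `L` has the one-step small lift `OneStepSmallLift F ℰp κ δ₀`.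
Proof: `ApproxLift.AnsatzT.stub_oneStepSmallLift` (p490827). [cite: Balaban1987RG1, (0.4) p.253, p.254 (small-field regions, Ū = V) and (0.16) p.255] -/
theorem stub_oneStepSmallLift :
    ∀ L : ℕ, ∃ κ δ₀ : ℝ, κ * Real.sqrt L ≤ 1 ∧ 0 < δ₀ ∧
      ∀ F : T3Family, F.L = L → OneStepSmallLift F ℰp κ δ₀ :=
  ApproxLift.AnsatzT.stub_oneStepSmallLift

end Summit.QuantumFields.YangMills.Theorems.IntLStub1

end
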